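import Literature.Probability.RandomPlanarGeometry.HexSAWStripAmplitudeRatio
import HarnessLib

/-!
# The levels of the first and of the last renewal point of a long critical β-walk are asymptotically independent, with laws
# `∝ Fℓ_a u_a` and `∝ ℓ_b Gℓ_b` (module «BETA-RENEWAL-LEVELS»)

Topic `Literature/Probability/RandomPlanarGeometry` (continues «AMPLITUDE-RATIO» `HexSAWStripAmplitudeRatio.lean` — explicit residues, fixed vectors
`HV.exists_pos_fixed_vectors_Iinf_stripYT`, `HV.tendsto_stripLenD_residue_explicit` — and «BETA-LENGTH-LAW» `HexSAWStripBetaLengthLaw.lean` — the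
level-pair renewal sums `HV.renLenPair T n a b = S_{ab}(n) = Σ_{i+j+k=n} fℓ_a(i) dℓ_{ab}(j) gℓ_b(k)` of the length-graded renewal split of the β-walks
(«BETA-LENGTH-SPLIT»: `HV.betaLenSum_eq_two_mul : bℓ_T(n) = 2(nℓ_T(n) + Σ_{a,b} S_{ab}(n))`), their Tannery limit `HV.tendsto_renLenPair_even` (hypothesis
form), `HV.exists_pos_tendsto_betaLenSum_even`, `HV.tendsto_noRenLen_atTop`, the masses `HV.headLenGF/tailLenGF` with `HV.headLenGF_one_pos`).
Lane «pcv-sawmu» (CriticalPhenomena venture), a-p2 g23.  Sources of the SETTING: W. Feller I (1968) XIII.11 (renewal processes with a first and a last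
piece of finite mass); H. Duminil-Copin, A. Hammond, CMP 324 (2013) §2.2 (renewal points of bridges); H. Duminil-Copin, S. Smirnov, Ann. Math. 175 (2012)
§3 (the strip and its symmetry).  Nothing of the kind is printed for the strip.

## What is proved (namespace `Literature.Probability.RandomPlanarGeometry.SAW.HV`; `y_T = stripYT T`, `T ≥ 2`; `u`, `ℓ` any positive right / left fixed
## vectors of `Iinf T y_T`; `Fℓ_a = headLenGF T a`, `Gℓ_b = tailLenGF T b`, `M̄_len` as in «AMPLITUDE-RATIO»)

* ★★ `tendsto_renLenPair_even_explicit` — `S_{ab}(2m) → Fℓ_a · 2u_aℓ_b/⟨ℓ, M̄_len u⟩ · Gℓ_b` (the tree's limit with its constant identified).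
* ★★★ `tendsto_renLenPair_div_betaRenewalLen` — `S_{ab}(2m)/Σ_{a′,b′} S_{a′b′}(2m) → (Fℓ_a u_a/Σ Fℓ u) · (ℓ_b Gℓ_b/Σ ℓ Gℓ)`: among the critical β-walks of
  length `2m` with a renewal point, the level of the FIRST renewal vertex and the level of the LAST one are asymptotically INDEPENDENT, with laws
  `∝ (head mass) × (entrance vector)` and `∝ (exit vector) × (tail mass)` — invariant under rescaling `u`, `ℓ`.
* ★★ `tendsto_firstRenewalLevel`, ★★ `tendsto_lastRenewalLevel` — the two marginal laws.
* ★★ `tendsto_two_mul_betaRenewalLen_div` — `2Σ_{a,b} S_{ab}(2m)/bℓ_T(2m) → 1`: walks without a renewal index are negligible at the threshold, so the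
  laws above concern (up to the mirror symmetry of the split) all β-walks of a given long length.
* ★★★ `tendsto_renLenTerm_div_betaRenewalLen` — THE FULL BOUNDARY LAW: `Φ_{2m}(i,k)_{ab}/Σ S(2m) → (fℓ_a(i)u_a/Σ Fℓ u)·(ℓ_b gℓ_b(k)/Σ ℓ Gℓ)`: the head
  (its size `i` and end level `a`) and the tail (its size `k` and start level `b`) of a long critical β-walk converge JOINTLY in law to a PRODUCT of the
  tilted head law and the tilted tail law (the delayed-renewal local limit, from the tree's Tannery term `tendsto_renLenTerm_even`).

Label: LANE THEOREM (own result of lane «pcv-sawmu», a-p2 g23, 2026-08-27); classical template = delayed renewal theory (Feller XIII.11).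
NOT claimed: the same laws in the CONTACT grading (the per-pair contact renewal sums are not exported by «BETA-COEFF»), `T = 1`, rates, the column POSITIONS of the renewal points.
-/

noncomputable section

open Finset Filter Topology Matrix Literature.Probability.LatticeModels Literature.Probability.Percolation
  Literature.Analysis.Matrix

namespace Literature.Probability.RandomPlanarGeometry.SAW

namespace HV

variable {T : ℕ} {u ℓ : Fin (2 * T) → ℝ}

/-- ★★ **The level-pair renewal sums, explicitly** (`T ≥ 2`): for any positive right/left fixed vectors `u`, `ℓ` of `Iinf T y_T` and all levels `a, b`,
`S_{ab}(2m) := Σ_{i+j+k=2m} fℓ_a(i) dℓ_{ab}(j) gℓ_b(k) ⟶ Fℓ_a · (2 u_a ℓ_b/⟨ℓ, M̄_len u⟩) · Gℓ_b` — the tree's `tendsto_renLenPair_even` with its constant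
identified by «AMPLITUDE-RATIO». [cite: Feller1968, XIII.11; DuminilCopinHammond2013, §2.2; lane «pcv-sawmu» a-p2 g23 — own] -/
theorem tendsto_renLenPair_even_explicit (hT : 2 ≤ T) (hu0 : ∀ a, 0 < u a) (hℓ0 : ∀ b, 0 < ℓ b)
    (hu : Iinf T (stripYT T) *ᵥ u = u) (hℓ : ℓ ᵥ* Iinf T (stripYT T) = ℓ) (a b : Fin (2 * T)) :
    Tendsto (fun m : ℕ => renLenPair T (2 * m) a b) atTop
      (𝓝 (headLenGF T (a : ℕ) *
        (2 * (u a * ℓ b / (ℓ ⬝ᵥ ((Matrix.of fun a b : Fin (2 * T) => ∑' n : ℕ, (n : ℝ) * LMM T n (n : ℤ) (stripYT T) a b) *ᵥ u)))) *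
        tailLenGF T (b : ℕ))) := by
  obtain ⟨u₃, ℓ₃, ρ₃, hu₃, hℓ₃, hρ₃, hres₃, hLUM₃⟩ := exists_tendsto_LUM_parity hT
  obtain ⟨-, hL⟩ := tendsto_stripLenD_residue_explicit hT hu0 hℓ0 hu hℓ
  have h := tendsto_renLenPair_even hT hu₃ hℓ₃ hρ₃ hLUM₃ a b
  have h3 : ρ₃ * (u₃ a * ℓ₃ b) = u a * ℓ b / _ := tendsto_nhds_unique (hres₃ a b) (hL a b)
  rw [h3] at h
  exact h

/-- ★★★ **ASYMPTOTIC INDEPENDENCE OF THE FIRST AND THE LAST RENEWAL LEVEL** (`T ≥ 2`).  Among the critical β-walks of `S_T` with `2m` vertices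
that have a renewal point (weight `x_c^{2m} y_T^{#top}`, counted through the renewal split), the fraction whose FIRST renewal vertex lies on level
`a` and whose LAST renewal vertex lies on level `b` tends to the PRODUCT
`(Fℓ_a u_a / Σ_{a′} Fℓ_{a′} u_{a′}) · (ℓ_b Gℓ_b / Σ_{b′} ℓ_{b′} Gℓ_{b′})`
— the two ends of a long critical walk decouple, the first renewal level being distributed ∝ (head mass)×(entrance vector) and the last
∝ (exit vector)×(tail mass), for any positive fixed vectors `u`, `ℓ` of the critical kernel (the laws do not depend on their scaling).
[cite: Feller1968, XIII.11 (renewal with delay: first and last pieces); DuminilCopinHammond2013, §2.2; lane «pcv-sawmu» a-p2 g23 — own result] -/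
theorem tendsto_renLenPair_div_betaRenewalLen (hT : 2 ≤ T) (hu0 : ∀ a, 0 < u a) (hℓ0 : ∀ b, 0 < ℓ b)
    (hu : Iinf T (stripYT T) *ᵥ u = u) (hℓ : ℓ ᵥ* Iinf T (stripYT T) = ℓ) (a b : Fin (2 * T)) :
    Tendsto (fun m : ℕ => renLenPair T (2 * m) a b / betaRenewalLen T (2 * m) (stripYT T)) atTop
      (𝓝 ((headLenGF T (a : ℕ) * u a / ∑ a' : Fin (2 * T), headLenGF T (a' : ℕ) * u a') *
        (ℓ b * tailLenGF T (b : ℕ) / ∑ b' : Fin (2 * T), ℓ b' * tailLenGF T (b' : ℕ)))) := by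
  have hT1 : 1 ≤ T := by omega
  obtain ⟨hl, -⟩ := tendsto_stripLenD_residue_explicit hT hu0 hℓ0 hu hℓ
  set dl := ℓ ⬝ᵥ ((Matrix.of fun a b : Fin (2 * T) => ∑' n : ℕ, (n : ℝ) * LMM T n (n : ℤ) (stripYT T) a b) *ᵥ u) with hdl
  have hpair := fun a b => tendsto_renLenPair_even_explicit hT hu0 hℓ0 hu hℓ a b
  -- the denominator
  have hden : Tendsto (fun m : ℕ => betaRenewalLen T (2 * m) (stripYT T)) atTop
      (𝓝 (∑ a' : Fin (2 * T), ∑ b' : Fin (2 * T), headLenGF T (a' : ℕ) * (2 * (u a' * ℓ b' / dl)) * tailLenGF T (b' : ℕ))) := by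
    simp only [betaRenewalLen_eq_sum_renLenPair]
    exact tendsto_finsetSum _ fun a' _ => tendsto_finsetSum _ fun b' _ => hpair a' b'
  -- positivity of the masses
  have hF0 : ∀ c : Fin (2 * T), 0 ≤ headLenGF T (c : ℕ) := fun c => (headGFN_le_headLenGF hT 0 ((c : ℕ) : ℤ) ((c : ℕ) : ℤ)).2.2.1
  have hG0 : ∀ c : Fin (2 * T), 0 ≤ tailLenGF T (c : ℕ) := fun c => (headGFN_le_headLenGF hT 0 ((c : ℕ) : ℤ) ((c : ℕ) : ℤ)).2.2.2
  obtain ⟨hF1, hGt⟩ := headLenGF_one_pos hT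
  have hFu : 0 < ∑ a' : Fin (2 * T), headLenGF T (a' : ℕ) * u a' := by
    refine sum_pos' (fun a' _ => mul_nonneg (hF0 a') (hu0 a').le) ⟨⟨1, by omega⟩, mem_univ _, mul_pos ?_ (hu0 _)⟩
    simpa using hF1
  have hℓG : 0 < ∑ b' : Fin (2 * T), ℓ b' * tailLenGF T (b' : ℕ) := by
    refine sum_pos' (fun b' _ => mul_nonneg (hℓ0 b').le (hG0 b')) ⟨⟨2 * T - 2, by omega⟩, mem_univ _, mul_pos (hℓ0 _) ?_⟩
    have hc : (((2 * T - 2 : ℕ) : ℕ) : ℤ) = 2 * (T : ℤ) - 2 := by omega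
    simpa [hc] using hGt
  have hsum : ∑ a' : Fin (2 * T), ∑ b' : Fin (2 * T), headLenGF T (a' : ℕ) * (2 * (u a' * ℓ b' / dl)) * tailLenGF T (b' : ℕ) =
      2 / dl * ((∑ a' : Fin (2 * T), headLenGF T (a' : ℕ) * u a') * ∑ b' : Fin (2 * T), ℓ b' * tailLenGF T (b' : ℕ)) := by
    rw [sum_mul_sum, mul_sum]
    refine sum_congr rfl fun a' _ => ?_
    rw [mul_sum]
    exact sum_congr rfl fun b' _ => by ring
  rw [hsum] at hden
  have hne : 2 / dl * ((∑ a' : Fin (2 * T), headLenGF T (a' : ℕ) * u a') * ∑ b' : Fin (2 * T), ℓ b' * tailLenGF T (b' : ℕ)) ≠ 0 :=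
    (mul_pos (div_pos two_pos hl) (mul_pos hFu hℓG)).ne'
  have hq := (hpair a b).div hden hne
  refine hq.congr' (Eventually.of_forall fun m => rfl) |>.trans ?_
  rw [show headLenGF T (a : ℕ) * (2 * (u a * ℓ b / dl)) * tailLenGF T (b : ℕ) /
      (2 / dl * ((∑ a' : Fin (2 * T), headLenGF T (a' : ℕ) * u a') * ∑ b' : Fin (2 * T), ℓ b' * tailLenGF T (b' : ℕ))) =
      headLenGF T (a : ℕ) * u a / (∑ a' : Fin (2 * T), headLenGF T (a' : ℕ) * u a') *
        (ℓ b * tailLenGF T (b : ℕ) / ∑ b' : Fin (2 * T), ℓ b' * tailLenGF T (b' : ℕ)) by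
    have := hl.ne'; field_simp]

/-- ★★ **The first renewal level alone**: the fraction of critical β-walks with `2m` vertices (and a renewal point) whose first renewal vertex
lies on level `a` tends to `Fℓ_a u_a / Σ_{a′} Fℓ_{a′} u_{a′}`. [cite: Feller1968, XIII.11; DuminilCopinHammond2013, §2.2; lane «pcv-sawmu» a-p2 g23 — own result] -/
theorem tendsto_firstRenewalLevel (hT : 2 ≤ T) (hu0 : ∀ a, 0 < u a) (hℓ0 : ∀ b, 0 < ℓ b)
    (hu : Iinf T (stripYT T) *ᵥ u = u) (hℓ : ℓ ᵥ* Iinf T (stripYT T) = ℓ) (a : Fin (2 * T)) :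
    Tendsto (fun m : ℕ => (∑ b : Fin (2 * T), renLenPair T (2 * m) a b) / betaRenewalLen T (2 * m) (stripYT T)) atTop
      (𝓝 (headLenGF T (a : ℕ) * u a / ∑ a' : Fin (2 * T), headLenGF T (a' : ℕ) * u a')) := by
  have hT1 : 1 ≤ T := by omega
  have h := tendsto_finsetSum (Finset.univ : Finset (Fin (2 * T))) fun b _ => tendsto_renLenPair_div_betaRenewalLen hT hu0 hℓ0 hu hℓ a b
  have hG0 : ∀ c : Fin (2 * T), 0 ≤ tailLenGF T (c : ℕ) := fun c => (headGFN_le_headLenGF hT 0 ((c : ℕ) : ℤ) ((c : ℕ) : ℤ)).2.2.2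
  obtain ⟨-, hGt⟩ := headLenGF_one_pos hT
  have hℓG : 0 < ∑ b' : Fin (2 * T), ℓ b' * tailLenGF T (b' : ℕ) := by
    refine sum_pos' (fun b' _ => mul_nonneg (hℓ0 b').le (hG0 b')) ⟨⟨2 * T - 2, by omega⟩, mem_univ _, mul_pos (hℓ0 _) ?_⟩
    have hc : (((2 * T - 2 : ℕ) : ℕ) : ℤ) = 2 * (T : ℤ) - 2 := by omega
    simpa [hc] using hGt
  have hval : ∑ b : Fin (2 * T), headLenGF T (a : ℕ) * u a / (∑ a' : Fin (2 * T), headLenGF T (a' : ℕ) * u a') *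
      (ℓ b * tailLenGF T (b : ℕ) / ∑ b' : Fin (2 * T), ℓ b' * tailLenGF T (b' : ℕ)) =
      headLenGF T (a : ℕ) * u a / ∑ a' : Fin (2 * T), headLenGF T (a' : ℕ) * u a' := by
    rw [← mul_sum, ← sum_div, div_self hℓG.ne', mul_one]
  rw [hval] at h
  refine h.congr fun m => ?_
  rw [sum_div]

/-- ★★ **The last renewal level alone**: the fraction whose last renewal vertex lies on level `b` tends to `ℓ_b Gℓ_b / Σ_{b′} ℓ_{b′} Gℓ_{b′}`.
[cite: Feller1968, XIII.11; DuminilCopinHammond2013, §2.2; lane «pcv-sawmu» a-p2 g23 — own result] -/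
theorem tendsto_lastRenewalLevel (hT : 2 ≤ T) (hu0 : ∀ a, 0 < u a) (hℓ0 : ∀ b, 0 < ℓ b)
    (hu : Iinf T (stripYT T) *ᵥ u = u) (hℓ : ℓ ᵥ* Iinf T (stripYT T) = ℓ) (b : Fin (2 * T)) :
    Tendsto (fun m : ℕ => (∑ a : Fin (2 * T), renLenPair T (2 * m) a b) / betaRenewalLen T (2 * m) (stripYT T)) atTop
      (𝓝 (ℓ b * tailLenGF T (b : ℕ) / ∑ b' : Fin (2 * T), ℓ b' * tailLenGF T (b' : ℕ))) := by
  have hT1 : 1 ≤ T := by omega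
  have h := tendsto_finsetSum (Finset.univ : Finset (Fin (2 * T))) fun a _ => tendsto_renLenPair_div_betaRenewalLen hT hu0 hℓ0 hu hℓ a b
  have hF0 : ∀ c : Fin (2 * T), 0 ≤ headLenGF T (c : ℕ) := fun c => (headGFN_le_headLenGF hT 0 ((c : ℕ) : ℤ) ((c : ℕ) : ℤ)).2.2.1
  obtain ⟨hF1, -⟩ := headLenGF_one_pos hT
  have hFu : 0 < ∑ a' : Fin (2 * T), headLenGF T (a' : ℕ) * u a' := by
    refine sum_pos' (fun a' _ => mul_nonneg (hF0 a') (hu0 a').le) ⟨⟨1, by omega⟩, mem_univ _, mul_pos ?_ (hu0 _)⟩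
    simpa using hF1
  have hval : ∑ a : Fin (2 * T), headLenGF T (a : ℕ) * u a / (∑ a' : Fin (2 * T), headLenGF T (a' : ℕ) * u a') *
      (ℓ b * tailLenGF T (b : ℕ) / ∑ b' : Fin (2 * T), ℓ b' * tailLenGF T (b' : ℕ)) =
      ℓ b * tailLenGF T (b : ℕ) / ∑ b' : Fin (2 * T), ℓ b' * tailLenGF T (b' : ℕ) := by
    rw [← sum_mul, ← sum_div, div_self hFu.ne', one_mul]
  rw [hval] at h
  refine h.congr fun m => ?_
  rw [sum_div]

/-- ★★ **Almost every long critical β-walk has a renewal point**: `2 · Σ_{a,b} S_{ab}(2m) / bℓ_T(2m) → 1` (`T ≥ 2`) — the β-walks WITHOUT a renewal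
index (together with their mirror images) are negligible at the threshold (`nℓ_T(n) → 0`, `bℓ_T(2m) → Λℓ_T > 0`), so the laws above are laws for
ALL β-walks of length `2m` up to the mirror symmetry of the split. [cite: DuminilCopinHammond2013, §2.2; DuminilCopinSmirnov2012, §3 (symmetry of S_T); lane «pcv-sawmu» a-p2 g23 — own result] -/
theorem tendsto_two_mul_betaRenewalLen_div (hT : 2 ≤ T) :
    Tendsto (fun m : ℕ => 2 * betaRenewalLen T (2 * m) (stripYT T) / betaLenSum T (2 * m) (stripYT T)) atTop (𝓝 1) := by
  have hT1 : 1 ≤ T := by omega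
  have hy : 0 ≤ stripYT T := (one_lt_stripYT hT1).le.trans' zero_le_one
  obtain ⟨Λ, hΛ0, hΛ, -⟩ := exists_pos_tendsto_betaLenSum_even hT
  have h2m : Tendsto (fun m : ℕ => 2 * m) atTop atTop := tendsto_atTop_atTop.2 fun n => ⟨n, fun m hm => by omega⟩
  have h0 : Tendsto (fun m : ℕ => 2 * noRenLen T (2 * m) (stripYT T)) atTop (𝓝 (2 * 0)) :=
    ((tendsto_noRenLen_atTop hT).comp h2m).const_mul 2
  rw [mul_zero] at h0
  -- `2 betaRenewalLen = bℓ − 2 nℓ`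
  have hR : Tendsto (fun m : ℕ => 2 * betaRenewalLen T (2 * m) (stripYT T)) atTop (𝓝 (Λ - 0)) := by
    refine (hΛ.sub h0).congr fun m => ?_
    rw [betaLenSum_eq_two_mul hT1 hy]; ring
  rw [sub_zero] at hR
  have := hR.div hΛ hΛ0.ne'
  rw [div_self hΛ0.ne'] at this
  exact this

/-- ★★★ **THE FULL BOUNDARY LAW: head and tail of a long critical β-walk are asymptotically independent, with explicit local laws** (`T ≥ 2`).
For every first-renewal level `a`, head size `i` (vertices), last-renewal level `b` and tail size `k` (steps), the fraction of the critical
β-walks of length `2m` (with a renewal point, weight `x_c^{2m} y_T^{#top}`) whose head has `i` vertices and ends on `a` and whose tail starts on `b`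
with `k` steps tends to the PRODUCT of two probability laws:
`Φ_{2m}(i,k)_{ab}/Σ_{a′,b′} S_{a′b′}(2m) → (fℓ_a(i) u_a / Σ_{a′} Fℓ_{a′} u_{a′}) · (ℓ_b gℓ_b(k) / Σ_{b′} ℓ_{b′} Gℓ_{b′})`
(`fℓ_a(i) = headLen T i a y_T`, `gℓ_b(k) = tailLen T k b y_T`; `Σ_i fℓ_a(i) = Fℓ_a`, `Σ_k gℓ_b(k) = Gℓ_b`) — the delayed-renewal local limit: the initial
and final pieces of a long critical walk converge in law to the normalised head / tail weights tilted by the entrance / exit vectors, independently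
of each other, while the middle bridge absorbs the length. [cite: Feller1968, XIII.11 (delayed renewal: the law of the delay); DuminilCopinHammond2013, §2.2; lane «pcv-sawmu» a-p2 g23 — own result] -/
theorem tendsto_renLenTerm_div_betaRenewalLen (hT : 2 ≤ T) (hu0 : ∀ a, 0 < u a) (hℓ0 : ∀ b, 0 < ℓ b)
    (hu : Iinf T (stripYT T) *ᵥ u = u) (hℓ : ℓ ᵥ* Iinf T (stripYT T) = ℓ) (a b : Fin (2 * T)) (i k : ℕ) :
    Tendsto (fun m : ℕ => renLenTerm T (2 * m) a b (i, k) / betaRenewalLen T (2 * m) (stripYT T)) atTop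
      (𝓝 ((headLen T i (a : ℕ) (stripYT T) * u a / ∑ a' : Fin (2 * T), headLenGF T (a' : ℕ) * u a') *
        (ℓ b * tailLen T k (b : ℕ) (stripYT T) / ∑ b' : Fin (2 * T), ℓ b' * tailLenGF T (b' : ℕ)))) := by
  have hT1 : 1 ≤ T := by omega
  obtain ⟨u₃, ℓ₃, ρ₃, hu₃, hℓ₃, hρ₃, hres₃, hLUM₃⟩ := exists_tendsto_LUM_parity hT
  obtain ⟨hl, hL⟩ := tendsto_stripLenD_residue_explicit hT hu0 hℓ0 hu hℓ
  set dl := ℓ ⬝ᵥ ((Matrix.of fun a b : Fin (2 * T) => ∑' n : ℕ, (n : ℝ) * LMM T n (n : ℤ) (stripYT T) a b) *ᵥ u) with hdl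
  have h3 : ∀ c d : Fin (2 * T), ρ₃ * (u₃ c * ℓ₃ d) = u c * ℓ d / dl := fun c d => tendsto_nhds_unique (hres₃ c d) (hL c d)
  -- numerator: the Tannery term
  have hnum := tendsto_renLenTerm_even hLUM₃ a b (i, k)
  rw [h3 a b] at hnum
  -- denominator
  have hpair := fun c d => tendsto_renLenPair_even hT hu₃ hℓ₃ hρ₃ hLUM₃ c d
  have hden : Tendsto (fun m : ℕ => betaRenewalLen T (2 * m) (stripYT T)) atTop
      (𝓝 (∑ a' : Fin (2 * T), ∑ b' : Fin (2 * T), headLenGF T (a' : ℕ) * (2 * (u a' * ℓ b' / dl)) * tailLenGF T (b' : ℕ))) := by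
    simp only [betaRenewalLen_eq_sum_renLenPair]
    refine tendsto_finsetSum _ fun a' _ => tendsto_finsetSum _ fun b' _ => ?_
    have h := hpair a' b'
    rw [h3 a' b'] at h
    exact h
  have hF0 : ∀ c : Fin (2 * T), 0 ≤ headLenGF T (c : ℕ) := fun c => (headGFN_le_headLenGF hT 0 ((c : ℕ) : ℤ) ((c : ℕ) : ℤ)).2.2.1
  have hG0 : ∀ c : Fin (2 * T), 0 ≤ tailLenGF T (c : ℕ) := fun c => (headGFN_le_headLenGF hT 0 ((c : ℕ) : ℤ) ((c : ℕ) : ℤ)).2.2.2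
  obtain ⟨hF1, hGt⟩ := headLenGF_one_pos hT
  have hFu : 0 < ∑ a' : Fin (2 * T), headLenGF T (a' : ℕ) * u a' := by
    refine sum_pos' (fun a' _ => mul_nonneg (hF0 a') (hu0 a').le) ⟨⟨1, by omega⟩, mem_univ _, mul_pos ?_ (hu0 _)⟩
    simpa using hF1
  have hℓG : 0 < ∑ b' : Fin (2 * T), ℓ b' * tailLenGF T (b' : ℕ) := by
    refine sum_pos' (fun b' _ => mul_nonneg (hℓ0 b').le (hG0 b')) ⟨⟨2 * T - 2, by omega⟩, mem_univ _, mul_pos (hℓ0 _) ?_⟩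
    have hc : (((2 * T - 2 : ℕ) : ℕ) : ℤ) = 2 * (T : ℤ) - 2 := by omega
    simpa [hc] using hGt
  have hsum : ∑ a' : Fin (2 * T), ∑ b' : Fin (2 * T), headLenGF T (a' : ℕ) * (2 * (u a' * ℓ b' / dl)) * tailLenGF T (b' : ℕ) =
      2 / dl * ((∑ a' : Fin (2 * T), headLenGF T (a' : ℕ) * u a') * ∑ b' : Fin (2 * T), ℓ b' * tailLenGF T (b' : ℕ)) := by
    rw [sum_mul_sum, mul_sum]
    refine sum_congr rfl fun a' _ => ?_
    rw [mul_sum]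
    exact sum_congr rfl fun b' _ => by ring
  rw [hsum] at hden
  have hne : 2 / dl * ((∑ a' : Fin (2 * T), headLenGF T (a' : ℕ) * u a') * ∑ b' : Fin (2 * T), ℓ b' * tailLenGF T (b' : ℕ)) ≠ 0 :=
    (mul_pos (div_pos two_pos hl) (mul_pos hFu hℓG)).ne'
  have hq := hnum.div hden hne
  simp only at hq
  refine hq.congr' (Eventually.of_forall fun m => rfl) |>.trans ?_
  rw [show headLen T i (a : ℕ) (stripYT T) * (2 * (u a * ℓ b / dl)) * tailLen T k (b : ℕ) (stripYT T) /
      (2 / dl * ((∑ a' : Fin (2 * T), headLenGF T (a' : ℕ) * u a') * ∑ b' : Fin (2 * T), ℓ b' * tailLenGF T (b' : ℕ))) =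
      headLen T i (a : ℕ) (stripYT T) * u a / (∑ a' : Fin (2 * T), headLenGF T (a' : ℕ) * u a') *
        (ℓ b * tailLen T k (b : ℕ) (stripYT T) / ∑ b' : Fin (2 * T), ℓ b' * tailLenGF T (b' : ℕ)) by
    have := hl.ne'; field_simp]

/-!
## Edition 2 (append-only, a-p2 g23)
§2 the same boundary laws in the CONTACT grading — ★★ `tendsto_renContactPair_explicit` (the per-pair form of
«BETA-COEFF» §8 with the explicit contact residue: `Σ_{i+j+k=m} f_a(i)d⁰_{ab}(j)g_b(k)·y_T^m → F_a·u_aℓ_b/(y_T⟨ℓ, M̄_top u⟩)·G_b`), ★★★ `tendsto_renContactPair_div`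
(among the critical β-walks with `m` surface contacts the first/last renewal levels follow the PRODUCT law `(F_a u_a/ΣFu)(ℓ_b G_b/ΣℓG)`, and this limit
EQUALS the length-grading limit since `Fℓ = F`, `Gℓ = G`), ★★ `tendsto_two_mul_betaRenewalSum_div` (`2·betaRenewalSum(m)/β_{T,m} → 1`).
-/

/-! ### §2 (edition 2) The same boundary laws in the CONTACT grading — and they coincide with the length-grading laws -/

section Contact

/-- ★★ **The level-pair renewal sums in the CONTACT grading, explicitly** (`T ≥ 2`): for all levels `a, b`,
`Σ_{i+j+k=m} f_a(i) d⁰_{ab}(j) g_b(k) · y_T^m ⟶ F_a · (u_aℓ_b/(y_T ⟨ℓ, M̄_top u⟩)) · G_b` — the per-pair form of «BETA-COEFF» §8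
(`tendsto_betaRenewalSum_mul_pow`, there summed over the levels) with the contact residue of «AMPLITUDE-RATIO» (two dominated convolutions, as there).
[cite: MadrasSlade1993, Appendix B (proof of Theorem B.1: dominated convergence for convolutions); Feller1968, XIII.11; DuminilCopinHammond2013, §2.2; lane «pcv-sawmu» a-p2 g23 — own] -/
theorem tendsto_renContactPair_explicit (hT : 2 ≤ T) (hu0 : ∀ a, 0 < u a) (hℓ0 : ∀ b, 0 < ℓ b)
    (hu : Iinf T (stripYT T) *ᵥ u = u) (hℓ : ℓ ᵥ* Iinf T (stripYT T) = ℓ) (a b : Fin (2 * T)) :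
    Tendsto (fun m : ℕ => ∑ p ∈ antidiagonal m, (headCoeff T p.1 a * stripYT T ^ p.1) *
        ∑ q ∈ antidiagonal p.2, (hb0Coeff T q.1 a b * stripYT T ^ q.1) * (tailCoeff T q.2 b * stripYT T ^ q.2)) atTop
      (𝓝 (headGF T a * ((u a * ℓ b /
        (ℓ ⬝ᵥ ((Matrix.of fun a b : Fin (2 * T) => ∑' j : ℕ, (j : ℝ) * irCoeff T j a b * stripYT T ^ (j - 1)) *ᵥ u)) / stripYT T) *
        tailGF T b))) := by
  have hT1 : 1 ≤ T := by omega
  have hyT := one_lt_stripYT hT1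
  have hy0 : 0 ≤ stripYT T := by linarith
  obtain ⟨hc, hC⟩ := tendsto_hKernel_residue_explicit hT hu0 hℓ0 hu hℓ
  set dc := ℓ ⬝ᵥ ((Matrix.of fun a b : Fin (2 * T) => ∑' j : ℕ, (j : ℝ) * irCoeff T j a b * stripYT T ^ (j - 1)) *ᵥ u) with hdc
  have hR : ∀ a b : Fin (2 * T), 0 < u a * ℓ b / dc := fun a b => div_pos (mul_pos (hu0 a) (hℓ0 b)) hc
  -- the three sequences
  set α : ℕ → ℝ := fun i => headCoeff T i a * stripYT T ^ i with hα
  set β : ℕ → ℝ := fun k => tailCoeff T k b * stripYT T ^ k with hβ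
  set δ : ℕ → ℝ := fun j => hb0Coeff T j a b * stripYT T ^ j with hδ
  have hα0 : ∀ i, 0 ≤ α i := fun i => mul_nonneg (headCoeffN_le_tendsto hT i _).2.1 (pow_nonneg hy0 _)
  have hβ0 : ∀ k, 0 ≤ β k := fun k => mul_nonneg (tailCoeffN_le_tendsto hT k _).2.1 (pow_nonneg hy0 _)
  have hδ0 : ∀ j, 0 ≤ δ j := fun j => mul_nonneg (hb0CoeffN_le_tendsto hT1 j a b).2.1 (pow_nonneg hy0 _)
  have hαs : Summable α := (summable_headCoeff_mul_pow hT _).1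
  have hβs : Summable β := (summable_tailCoeff_mul_pow hT _).1
  have hd : Tendsto (fun j => hbCoeff T j a b * stripYT T ^ j) atTop (𝓝 (u a * ℓ b / dc / stripYT T)) :=
    tendsto_hbCoeff_mul_pow_of_residue hT hR hC a b
  have hδlim : Tendsto δ atTop (𝓝 (u a * ℓ b / dc / stripYT T)) := by
    refine hd.congr' ?_
    filter_upwards [eventually_ge_atTop 1] with j hj
    simp only [hδ]
    rw [hb0Coeff_eq_hbCoeff hj]
  obtain ⟨B, hB⟩ := hd.bddAbove_range
  have hB' : ∀ j, hbCoeff T j a b * stripYT T ^ j ≤ B := fun j => hB ⟨j, rfl⟩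
  set K : ℝ := ((stripChains T 0).card : ℝ) with hK
  have hδB : ∀ j, |δ j| ≤ B + K := by
    intro j
    rw [abs_of_nonneg (hδ0 j)]
    simp only [hδ]
    rcases Nat.eq_zero_or_pos j with rfl | hj
    · have h0 := hB' 0
      have := hb0Coeff_le_hbCoeff_add hT1 0 a b
      rw [pow_zero, mul_one] at h0 ⊢
      linarith
    · rw [hb0Coeff_eq_hbCoeff hj]
      linarith [hB' j, hK ▸ (Nat.cast_nonneg _ : (0 : ℝ) ≤ ((stripChains T 0).card : ℝ))]
  have hBK : 0 ≤ B + K := (abs_nonneg _).trans (hδB 0)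
  set U : ℕ → ℝ := fun n => ∑ q ∈ antidiagonal n, δ q.1 * β q.2 with hU
  have hUswap : ∀ n, U n = ∑ q ∈ antidiagonal n, β q.1 * δ q.2 := by
    intro n
    simp only [hU]
    rw [← Finset.Nat.sum_antidiagonal_swap]
    exact sum_congr rfl fun q _ => by simp only [Prod.fst_swap, Prod.snd_swap]; ring
  have hUlim : Tendsto U atTop (𝓝 ((∑' k, β k) * (u a * ℓ b / dc / stripYT T))) :=
    (Literature.Probability.Process.Renewal.tendsto_sum_antidiagonal_mul hβ0 hβs hδB hδlim).congr
      fun n => (hUswap n).symm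
  have hU0 : ∀ n, 0 ≤ U n := fun n => sum_nonneg fun q _ => mul_nonneg (hδ0 _) (hβ0 _)
  have hUB : ∀ n, |U n| ≤ (B + K) * ∑' k, β k := by
    intro n
    rw [abs_of_nonneg (hU0 n), hUswap n]
    calc ∑ q ∈ antidiagonal n, β q.1 * δ q.2 ≤ ∑ q ∈ antidiagonal n, β q.1 * (B + K) :=
          sum_le_sum fun q _ => mul_le_mul_of_nonneg_left ((le_abs_self _).trans (hδB _)) (hβ0 _)
      _ = (B + K) * ∑ q ∈ antidiagonal n, β q.1 := by rw [← sum_mul, mul_comm]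
      _ ≤ (B + K) * ∑' k, β k := by
          refine mul_le_mul_of_nonneg_left ?_ hBK
          rw [Finset.Nat.sum_antidiagonal_eq_sum_range_succ_mk]
          exact hβs.sum_le_tsum (range (n + 1)) fun k _ => hβ0 k
  have hlim := Literature.Probability.Process.Renewal.tendsto_sum_antidiagonal_mul hα0 hαs hUB hUlim
  have hval : (∑' i, α i) * ((∑' k, β k) * (u a * ℓ b / dc / stripYT T)) =
      headGF T a * ((u a * ℓ b / dc / stripYT T) * tailGF T b) := by
    simp only [hα, hβ, headGF, tailGF]; ring
  rw [← hval]
  refine hlim.congr fun m => ?_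
  simp only [hU, hα, hβ, hδ]

/-- ★★★ **THE BOUNDARY LAWS IN THE CONTACT GRADING — and their agreement with the length grading** (`T ≥ 2`).  Among the critical β-walks with
exactly `m` surface contacts (weight `x_c^{|ω|}`, renewal split of «BETA-SPLIT»), the fraction whose first renewal vertex is on level `a` and last on
level `b` tends, as `m → ∞`, to `(F_a u_a/Σ F u)·(ℓ_b G_b/Σ ℓ G)` — a PRODUCT law; and since `Fℓ = F`, `Gℓ = G` («BETA-HEAD-TAIL-MASSES») this is
literally the SAME limit as in the length grading (`tendsto_renLenPair_div_betaRenewalLen`): where a long critical walk first and last renews does not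
depend on whether «long» means many contacts or many steps. [cite: Feller1968, XIII.11; DuminilCopinHammond2013, §2.2; BeatonBousquetMelouDeGierDuminilCopinGuttmann2014, §3.2; lane «pcv-sawmu» a-p2 g23 — own result] -/
theorem tendsto_renContactPair_div (hT : 2 ≤ T) (hu0 : ∀ a, 0 < u a) (hℓ0 : ∀ b, 0 < ℓ b)
    (hu : Iinf T (stripYT T) *ᵥ u = u) (hℓ : ℓ ᵥ* Iinf T (stripYT T) = ℓ) (a b : Fin (2 * T)) :
    Tendsto (fun m : ℕ => (∑ p ∈ antidiagonal m, (headCoeff T p.1 a * stripYT T ^ p.1) *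
        ∑ q ∈ antidiagonal p.2, (hb0Coeff T q.1 a b * stripYT T ^ q.1) * (tailCoeff T q.2 b * stripYT T ^ q.2)) /
        (betaRenewalSum T m * stripYT T ^ m)) atTop
      (𝓝 ((headGF T a * u a / ∑ a' : Fin (2 * T), headGF T a' * u a') *
        (ℓ b * tailGF T b / ∑ b' : Fin (2 * T), ℓ b' * tailGF T b'))) ∧
    (headGF T a * u a / ∑ a' : Fin (2 * T), headGF T a' * u a') * (ℓ b * tailGF T b / ∑ b' : Fin (2 * T), ℓ b' * tailGF T b') =
      (headLenGF T (a : ℕ) * u a / ∑ a' : Fin (2 * T), headLenGF T (a' : ℕ) * u a') *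
        (ℓ b * tailLenGF T (b : ℕ) / ∑ b' : Fin (2 * T), ℓ b' * tailLenGF T (b' : ℕ)) := by
  have hT1 : 1 ≤ T := by omega
  have hyT : 0 < stripYT T := stripYT_pos hT1
  obtain ⟨hc, -⟩ := tendsto_hKernel_residue_explicit hT hu0 hℓ0 hu hℓ
  have hpair := fun c d => tendsto_renContactPair_explicit hT hu0 hℓ0 hu hℓ c d
  set dc := ℓ ⬝ᵥ ((Matrix.of fun a b : Fin (2 * T) => ∑' j : ℕ, (j : ℝ) * irCoeff T j a b * stripYT T ^ (j - 1)) *ᵥ u) with hdc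
  have hFG := fun c : Fin (2 * T) => headLenGF_eq_headGF hT ((c : ℕ) : ℤ) ((c : ℕ) : ℤ)
  refine ⟨?_, by simp_rw [(hFG _).1, (hFG _).2]⟩
  -- denominator
  have hden : Tendsto (fun m : ℕ => betaRenewalSum T m * stripYT T ^ m) atTop
      (𝓝 (∑ a' : Fin (2 * T), ∑ b' : Fin (2 * T), headGF T a' * ((u a' * ℓ b' / dc / stripYT T) * tailGF T b'))) := by
    simp_rw [betaRenewalSum_mul_pow_eq]
    exact tendsto_finsetSum _ fun a' _ => tendsto_finsetSum _ fun b' _ => hpair a' b'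
  have hF0 : ∀ c : Fin (2 * T), 0 ≤ headGF T c := fun c => (headGF_tailGF_nonneg hT ((c : ℕ) : ℤ) ((c : ℕ) : ℤ)).1
  have hG0 : ∀ c : Fin (2 * T), 0 ≤ tailGF T c := fun c => (headGF_tailGF_nonneg hT ((c : ℕ) : ℤ) ((c : ℕ) : ℤ)).2
  have hF1 := headGF_one_pos hT
  have hGt := tailGF_top_pos hT
  have hFu : 0 < ∑ a' : Fin (2 * T), headGF T a' * u a' := by
    refine sum_pos' (fun a' _ => mul_nonneg (hF0 a') (hu0 a').le) ⟨⟨1, by omega⟩, mem_univ _, mul_pos ?_ (hu0 _)⟩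
    simpa using hF1
  have hℓG : 0 < ∑ b' : Fin (2 * T), ℓ b' * tailGF T b' := by
    refine sum_pos' (fun b' _ => mul_nonneg (hℓ0 b').le (hG0 b')) ⟨⟨2 * T - 2, by omega⟩, mem_univ _, mul_pos (hℓ0 _) ?_⟩
    have hcast : (((2 * T - 2 : ℕ) : ℕ) : ℤ) = 2 * (T : ℤ) - 2 := by omega
    simpa [hcast] using hGt
  have hsum : ∑ a' : Fin (2 * T), ∑ b' : Fin (2 * T), headGF T a' * ((u a' * ℓ b' / dc / stripYT T) * tailGF T b') =
      1 / (dc * stripYT T) * ((∑ a' : Fin (2 * T), headGF T a' * u a') * ∑ b' : Fin (2 * T), ℓ b' * tailGF T b') := by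
    rw [sum_mul_sum, mul_sum]
    refine sum_congr rfl fun a' _ => ?_
    rw [mul_sum]
    exact sum_congr rfl fun b' _ => by rw [div_div]; ring
  rw [hsum] at hden
  have hne : 1 / (dc * stripYT T) * ((∑ a' : Fin (2 * T), headGF T a' * u a') * ∑ b' : Fin (2 * T), ℓ b' * tailGF T b') ≠ 0 :=
    (mul_pos (div_pos one_pos (mul_pos hc hyT)) (mul_pos hFu hℓG)).ne'
  have hq := (hpair a b).div hden hne
  refine hq.congr' (Eventually.of_forall fun m => rfl) |>.trans ?_
  rw [show headGF T a * ((u a * ℓ b / dc / stripYT T) * tailGF T b) /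
      (1 / (dc * stripYT T) * ((∑ a' : Fin (2 * T), headGF T a' * u a') * ∑ b' : Fin (2 * T), ℓ b' * tailGF T b')) =
      headGF T a * u a / (∑ a' : Fin (2 * T), headGF T a' * u a') * (ℓ b * tailGF T b / ∑ b' : Fin (2 * T), ℓ b' * tailGF T b') by
    have := hc.ne'; have := hyT.ne'; field_simp]

/-- ★★ **In the contact grading, too, almost every long β-walk has a renewal point**: `2·betaRenewalSum(m)/β_{T,m} → 1` (`T ≥ 2`; the two-sided split
`2·betaRenewalSum ≤ β_{T,m} ≤ 2(n(m) + betaRenewalSum)` of «BETA-COEFF» with `n(m)y_T^m → 0` and `β_{T,m}y_T^m → Λ_T > 0`).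
[cite: DuminilCopinHammond2013, §2.2; BeatonBousquetMelouDeGierDuminilCopinGuttmann2014, §3.2; lane «pcv-sawmu» a-p2 g23 — own result] -/
theorem tendsto_two_mul_betaRenewalSum_div (hT : 2 ≤ T) :
    Tendsto (fun m : ℕ => 2 * betaRenewalSum T m / stripBcoeff T m) atTop (𝓝 1) := by
  have hT1 : 1 ≤ T := by omega
  have hyT : 0 < stripYT T := stripYT_pos hT1
  obtain ⟨u₁, ℓ₁, ρ₁, hu₁, hℓ₁, hρ₁, -, hB⟩ := exists_tendsto_stripBcoeff_mul_pow hT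
  obtain ⟨Λ, hΛ0, hΛ⟩ := exists_pos_tendsto_stripBcoeff_mul_pow hT
  -- `2 bRS y^m` is squeezed between `β y^m − 2 n y^m` and `β y^m`
  have hn : Tendsto (fun m : ℕ => noRenCoeff T m * stripYT T ^ m) atTop (𝓝 0) := (summable_noRenCoeff_mul_pow hT).2
  have hlow : Tendsto (fun m : ℕ => stripBcoeff T m * stripYT T ^ m - 2 * (noRenCoeff T m * stripYT T ^ m)) atTop (𝓝 (Λ - 2 * 0)) :=
    hΛ.sub (hn.const_mul 2)
  rw [mul_zero, sub_zero] at hlow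
  have hR : Tendsto (fun m : ℕ => 2 * betaRenewalSum T m * stripYT T ^ m) atTop (𝓝 Λ) := by
    refine tendsto_of_tendsto_of_tendsto_of_le_of_le hlow hΛ (fun m => ?_) (fun m => ?_)
    · have h := mul_le_mul_of_nonneg_right (stripBcoeff_le_two_mul hT m) (pow_nonneg hyT.le m)
      simp only
      linarith
    · exact mul_le_mul_of_nonneg_right (two_mul_betaRenewalSum_le_stripBcoeff hT m) (pow_nonneg hyT.le m)
  have h := hR.div hΛ hΛ0.ne'
  rw [div_self hΛ0.ne'] at h
  refine h.congr' ?_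
  filter_upwards [hΛ.eventually (eventually_ne_nhds hΛ0.ne')] with m hm
  have hpow : stripYT T ^ m ≠ 0 := pow_ne_zero m hyT.ne'
  rw [Pi.div_apply, mul_div_mul_right _ _ hpow]

end Contact

end HV

end Literature.Probability.RandomPlanarGeometry.SAW
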